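import Summits.Parity.BatemanHorn.Theorems.SoloInformedPrimeSquareValues
import Summits.Parity.BatemanHorn.Theorems.SoloInformedPowerValuesCount

/-!
# SoloInformedCubicPrimeCount — the `π`-level localisation for every CUBIC Bateman–Horn polynomial

Solo unit `solo-Parity-informed` (ideation tier, informed mode), session 14; `PLAN.md` §22.5, CLAIMS C64.

For `g ∈ ℤ[X]` with `IsBatemanHornSystem ![g]` and `deg g = 3` (e.g. `n³ + 2`) the proper-prime-power term is
negligible UNCONDITIONALLY, with Mathlib-only inputs:

  `PP_g(x) = ∑_{1 ≤ n ≤ x, |g(n)| not prime} Λ(|g(n)|) = o(x)`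
  (`properPrimePow_sum_isLittleO_of_natDegree_three`):

a value `|g(n)| = p^k`, `k ≥ 2`, with `n ≥ n₀` (`g > 0` there) is a prime square (`k = 2`; negligible by the
one-non-residue local sieve `SoloInformedPrimeSquareValues`), a cube (`k = 3`; negligible by the Liouville
spacing count `SoloInformedPowerValuesCount`), or has `k ≥ 4`, `p ≤ (e^B x³)^{1/4}` (at most `O(x^{3/4} log x)`
values, each taken `≤ 6` times); and `Λ(|g(n)|) ≤ 3 log x + B`.  Consequently:

* `batemanHornAsymptotic_iff_isEquivalent_psi_of_natDegree_three`,
* `batemanHornAsymptotic_iff_largeDivisorSum_isLittleO_of_natDegree_three` (every admissible cut) and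
  `batemanHornAsymptotic_iff_largeDivisorSum_isLittleO_rpowCut_of_natDegree_three` (`y = x^{1-ε}`):
    `BatemanHornAsymptotic ![g] ⟺ T_g(x; y) = ∑_{n ≤ x} ∑_{d ∣ |g(n)|, d > y} μ(d) log d = o(x)`.

No bearing on the truth of the conjecture.
-/

namespace Summit.Parity.BatemanHorn.Theorems

open Finset Filter ArithmeticFunction Asymptotics Polynomial
open scoped ArithmeticFunction.Moebius Topology Classical
open Literature.NumberTheory.Sieve (IsBatemanHornSystem batemanHornConst BatemanHornAsymptotic)

/-! ### The proper-prime-power term: a counting bound -/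

/-- **`PP_g(x) ≤ (3 log x + B) · (n₀ + #prime squares + #cubes + #higher powers)`** for a cubic `g` with
`g(n) > 0` for `n ≥ n₀` and `|log |g(n)| - 3 log n| ≤ B`. -/
theorem properPrimePow_polyVal_sum_le_three (g : ℤ[X]) (hdeg : g.natDegree = 3) {n₀ : ℕ}
    (hpos : ∀ n : ℕ, n₀ ≤ n → 0 < g.eval (n : ℤ)) {B : ℝ}
    (hB : ∀ n : ℕ, 1 ≤ n → |Real.log ((g.eval (n : ℤ)).natAbs : ℝ) - g.natDegree * Real.log n| ≤ B)
    {x : ℕ} (hx : 1 ≤ x) :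
    ∑ n ∈ (Icc 1 x).filter (fun n : ℕ => ¬Nat.Prime (g.eval (n : ℤ)).natAbs), Λ (g.eval (n : ℤ)).natAbs
      ≤ (3 * Real.log x + B) * (n₀
          + #((Icc 1 x).filter fun n : ℕ => ∃ p : ℕ, p.Prime ∧ g.eval (n : ℤ) = (p : ℤ) ^ 2)
          + #((Icc 1 x).filter fun n : ℕ => ∃ m : ℕ, (g.eval (n : ℤ)).natAbs = m ^ 3)
          + #((range (⌊(Real.exp B * (x : ℝ) ^ 3) ^ (1 / 4 : ℝ)⌋₊ + 1)).biUnion fun m : ℕ =>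
              (range (⌊Real.log (Real.exp B * (x : ℝ) ^ 3) / Real.log 2⌋₊ + 1)).biUnion fun k : ℕ =>
                (Icc 1 x).filter fun n : ℕ => (g.eval (n : ℤ)).natAbs = m ^ k)) := by
  set Y : ℝ := Real.exp B * (x : ℝ) ^ 3 with hY
  set P := ⌊Y ^ (1 / 4 : ℝ)⌋₊ with hP
  set K := ⌊Real.log Y / Real.log 2⌋₊ with hK
  set NP := (Icc 1 x).filter (fun n : ℕ => ¬Nat.Prime (g.eval (n : ℤ)).natAbs) with hNP
  set SQ := (Icc 1 x).filter (fun n : ℕ => ∃ p : ℕ, p.Prime ∧ g.eval (n : ℤ) = (p : ℤ) ^ 2) with hSQ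
  set CB := (Icc 1 x).filter (fun n : ℕ => ∃ m : ℕ, (g.eval (n : ℤ)).natAbs = m ^ 3) with hCB
  set HI := (range (P + 1)).biUnion (fun m : ℕ => (range (K + 1)).biUnion fun k : ℕ =>
    (Icc 1 x).filter fun n : ℕ => (g.eval (n : ℤ)).natAbs = m ^ k) with hHI
  have hx0 : (0 : ℝ) < x := by exact_mod_cast hx
  have hlogx : 0 ≤ Real.log x := Real.log_nonneg (by exact_mod_cast hx)
  have hY0 : 0 < Y := by positivity
  have hlog2 : 0 < Real.log 2 := Real.log_pos (by norm_num)
  -- pointwise bound for the weights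
  have hw : ∀ n ∈ NP.filter (fun n : ℕ => Λ (g.eval (n : ℤ)).natAbs ≠ 0),
      Λ (g.eval (n : ℤ)).natAbs ≤ 3 * Real.log x + B := by
    intro n hn
    obtain ⟨hn, -⟩ := mem_filter.mp hn
    obtain ⟨hn1, hnx⟩ := mem_Icc.mp (mem_filter.mp hn).1
    have h1 := (abs_le.mp (hB n hn1)).2
    rw [hdeg] at h1
    have h2 : Real.log n ≤ Real.log x :=
      Real.log_le_log (by exact_mod_cast hn1) (by exact_mod_cast hnx)
    push_cast at h1
    linarith [vonMangoldt_le_log (n := (g.eval (n : ℤ)).natAbs)]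
  -- where the non-zero weights live
  have hsub : NP.filter (fun n : ℕ => Λ (g.eval (n : ℤ)).natAbs ≠ 0) ⊆ range n₀ ∪ SQ ∪ CB ∪ HI := by
    intro n hn
    obtain ⟨hnNP, hΛ⟩ := mem_filter.mp hn
    obtain ⟨hnI, hnp⟩ := mem_filter.mp hnNP
    obtain ⟨hn1, hnx⟩ := mem_Icc.mp hnI
    obtain ⟨p, k, hp, hk, hpk⟩ := (isPrimePow_nat_iff _).mp (vonMangoldt_ne_zero_iff.mp hΛ)
    rw [mem_union, mem_union, mem_union]
    by_cases hn0 : n < n₀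
    · exact Or.inl (Or.inl (Or.inl (mem_range.mpr hn0)))
    have hgpos : 0 < g.eval (n : ℤ) := hpos n (not_lt.mp hn0)
    have hk1 : k ≠ 1 := by
      rintro rfl
      rw [pow_one] at hpk
      exact hnp (hpk ▸ hp)
    by_cases hk2 : k = 2
    · -- a prime square
      refine Or.inl (Or.inl (Or.inr (mem_filter.mpr ⟨hnI, p, hp, ?_⟩)))
      rw [← Int.natAbs_of_nonneg hgpos.le, ← hpk, hk2]
      push_cast
      ring
    by_cases hk3 : k = 3
    · -- a cube
      refine Or.inl (Or.inr (mem_filter.mpr ⟨hnI, p, ?_⟩))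
      rw [← hpk, hk3]
    · -- a higher power: `p ≤ P`, `k ≤ K`
      have hk4 : 4 ≤ k := by omega
      have hgY : (((g.eval (n : ℤ)).natAbs : ℕ) : ℝ) ≤ Y := by
        have h1 := (abs_le.mp (hB n hn1)).2
        rw [hdeg] at h1
        push_cast at h1
        have h2 : Real.log n ≤ Real.log x :=
          Real.log_le_log (by exact_mod_cast hn1) (by exact_mod_cast hnx)
        have hg0 : (0 : ℝ) < ((g.eval (n : ℤ)).natAbs : ℕ) := by
          rw [← hpk]
          exact_mod_cast pow_pos hp.pos k
        rw [← Real.exp_log hg0, hY, show Real.exp B * (x : ℝ) ^ 3 = Real.exp (Real.log ((x : ℝ) ^ 3) + B) by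
          rw [Real.exp_add, Real.exp_log (by positivity), mul_comm]]
        refine Real.exp_le_exp.mpr ?_
        rw [Real.log_pow]
        push_cast
        linarith
      have hpkR : ((p : ℝ) ^ k) = (((g.eval (n : ℤ)).natAbs : ℕ) : ℝ) := by exact_mod_cast hpk
      have hpP : p ∈ range (P + 1) := by
        rw [mem_range, Nat.lt_add_one_iff, hP]
        refine Nat.le_floor ?_
        have h4 : (p : ℝ) ^ 4 ≤ Y := by
          calc (p : ℝ) ^ 4 ≤ (p : ℝ) ^ k := pow_le_pow_right₀ (by exact_mod_cast hp.one_lt.le) hk4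
            _ ≤ Y := hpkR ▸ hgY
        have hroot : ((p : ℝ) ^ 4) ^ (1 / 4 : ℝ) = p := by
          rw [one_div, show (4 : ℝ)⁻¹ = ((4 : ℕ) : ℝ)⁻¹ by norm_num]
          exact Real.pow_rpow_inv_natCast (Nat.cast_nonneg p) (by norm_num)
        calc (p : ℝ) = ((p : ℝ) ^ 4) ^ (1 / 4 : ℝ) := hroot.symm
          _ ≤ Y ^ (1 / 4 : ℝ) := Real.rpow_le_rpow (by positivity) h4 (by norm_num)
      have hkK : k ∈ range (K + 1) := by
        rw [mem_range, Nat.lt_add_one_iff, hK]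
        refine Nat.le_floor ?_
        rw [le_div_iff₀ hlog2]
        have h2k : (2 : ℝ) ^ k ≤ Y := by
          calc (2 : ℝ) ^ k ≤ (p : ℝ) ^ k := pow_le_pow_left₀ (by norm_num) (by exact_mod_cast hp.two_le) k
            _ ≤ Y := hpkR ▸ hgY
        have := Real.log_le_log (by positivity) h2k
        rwa [Real.log_pow] at this
      exact Or.inr (mem_biUnion.mpr ⟨p, hpP, mem_biUnion.mpr ⟨k, hkK, mem_filter.mpr ⟨hnI, hpk.symm⟩⟩⟩)
  -- sum ≤ (max weight) · (number of non-zero weights)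
  have hcard : (#(NP.filter fun n : ℕ => Λ (g.eval (n : ℤ)).natAbs ≠ 0) : ℝ) ≤ n₀ + #SQ + #CB + #HI := by
    have h := (card_le_card hsub).trans ((card_union_le _ _).trans (Nat.add_le_add_right
      ((card_union_le _ _).trans (Nat.add_le_add_right (card_union_le _ _) _)) _))
    rw [card_range] at h
    exact_mod_cast h
  calc ∑ n ∈ NP, Λ (g.eval (n : ℤ)).natAbs
      = ∑ n ∈ NP.filter (fun n : ℕ => Λ (g.eval (n : ℤ)).natAbs ≠ 0), Λ (g.eval (n : ℤ)).natAbs :=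
        (sum_filter_ne_zero NP).symm
    _ ≤ #(NP.filter fun n : ℕ => Λ (g.eval (n : ℤ)).natAbs ≠ 0) • (3 * Real.log x + B) :=
        sum_le_card_nsmul _ _ _ hw
    _ ≤ (3 * Real.log x + B) * (n₀ + #SQ + #CB + #HI) := by
        rw [nsmul_eq_mul, mul_comm]
        have hB0 : 0 ≤ B := (abs_nonneg _).trans (hB 1 le_rfl)
        have hw0 : 0 ≤ 3 * Real.log x + B := by linarith
        gcongr

/-! ### The higher-power count is `O(x^{3/4} (log x)²)`, hence negligible -/

/-- For every `B ≥ 0` and `δ > 0`: eventually `4 log x · 6 (P_x + 1)(K_x + 1) ≤ δ x`, where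
`P_x = ⌊(e^B x³)^{1/4}⌋`, `K_x = ⌊log(e^B x³)/log 2⌋`. -/
theorem eventually_higherPow_count_mul_log_le_three {B : ℝ} (hB0 : 0 ≤ B) {δ : ℝ} (hδ : 0 < δ) :
    ∀ᶠ x : ℕ in atTop, 4 * Real.log x *
      (((⌊(Real.exp B * (x : ℝ) ^ 3) ^ (1 / 4 : ℝ)⌋₊ + 1)
        * (⌊Real.log (Real.exp B * (x : ℝ) ^ 3) / Real.log 2⌋₊ + 1) * (2 * 3) : ℕ) : ℝ) ≤ δ * x := by
  set c₀ : ℝ := Real.exp (B / 4) with hc₀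
  have hc₀0 : 0 < c₀ := Real.exp_pos _
  have hlog2 : 0 < Real.log 2 := Real.log_pos (by norm_num)
  have hlog2' : Real.log 2 < 1 := by
    have := Real.log_two_lt_d9; norm_num at this; linarith
  set η : ℝ := δ * Real.log 2 / (240 * c₀) with hη
  have hη0 : 0 < η := by positivity
  have hlo := ((isLittleO_log_rpow_rpow_atTop 2 (show (0 : ℝ) < 1 / 4 by norm_num)).comp_tendsto
    tendsto_natCast_atTop_atTop).def hη0
  have hlog : Tendsto (fun x : ℕ => Real.log x) atTop atTop :=
    Real.tendsto_log_atTop.comp tendsto_natCast_atTop_atTop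
  filter_upwards [hlo, hlog.eventually (eventually_ge_atTop (max B 1)), eventually_ge_atTop 1]
    with x hx hL hx1
  simp only [Function.comp_apply, Real.norm_eq_abs, Real.rpow_two] at hx
  rw [abs_of_nonneg (sq_nonneg _), abs_of_nonneg (by positivity)] at hx
  set L := Real.log x with hL'
  have hBL : B ≤ L := le_trans (le_max_left _ _) hL
  have hL1 : 1 ≤ L := le_trans (le_max_right _ _) hL
  have hL0 : 0 ≤ L := by linarith
  have hx0 : (0 : ℝ) < x := by exact_mod_cast hx1
  have hlog2ne : Real.log 2 ≠ 0 := hlog2.ne'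
  -- `Y^{1/4} = c₀ x^{3/4}`, `log Y = B + 3 L`
  have hY4 : (Real.exp B * (x : ℝ) ^ 3) ^ (1 / 4 : ℝ) = c₀ * (x : ℝ) ^ (3 / 4 : ℝ) := by
    rw [Real.mul_rpow (Real.exp_pos _).le (by positivity), hc₀, ← Real.exp_mul,
      show ((x : ℝ) ^ 3) = (x : ℝ) ^ (3 : ℝ) by exact_mod_cast (Real.rpow_natCast (x : ℝ) 3).symm,
      ← Real.rpow_mul hx0.le,
      show B * (1 / 4 : ℝ) = B / 4 by ring, show (3 : ℝ) * (1 / 4) = 3 / 4 by norm_num]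
  have hlogY : Real.log (Real.exp B * (x : ℝ) ^ 3) = B + 3 * L := by
    rw [Real.log_mul (Real.exp_pos _).ne' (by positivity), Real.log_exp, Real.log_pow]
    push_cast
    ring
  have hx34 : 1 ≤ c₀ * (x : ℝ) ^ (3 / 4 : ℝ) := by
    have h1 : 1 ≤ c₀ := by rw [hc₀]; exact Real.one_le_exp (by positivity)
    have h2 : (1 : ℝ) ≤ (x : ℝ) ^ (3 / 4 : ℝ) := Real.one_le_rpow (by exact_mod_cast hx1) (by norm_num)
    nlinarith
  -- the two factors
  have hP : ((⌊(Real.exp B * (x : ℝ) ^ 3) ^ (1 / 4 : ℝ)⌋₊ : ℕ) : ℝ) + 1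
      ≤ 2 * (c₀ * (x : ℝ) ^ (3 / 4 : ℝ)) := by
    have hfl := Nat.floor_le (show 0 ≤ (Real.exp B * (x : ℝ) ^ 3) ^ (1 / 4 : ℝ) by positivity)
    linarith [hY4]
  have hK : ((⌊Real.log (Real.exp B * (x : ℝ) ^ 3) / Real.log 2⌋₊ : ℕ) : ℝ) + 1 ≤ 5 * L / Real.log 2 := by
    have hfl := Nat.floor_le (show 0 ≤ Real.log (Real.exp B * (x : ℝ) ^ 3) / Real.log 2 by
      rw [hlogY]; positivity)
    have e : Real.log (Real.exp B * (x : ℝ) ^ 3) / Real.log 2 + 1 ≤ 5 * L / Real.log 2 := by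
      rw [hlogY, div_add_one hlog2ne, div_le_div_iff_of_pos_right hlog2]
      linarith
    linarith
  -- assemble
  have hx' : (x : ℝ) ^ (3 / 4 : ℝ) * (x : ℝ) ^ (1 / 4 : ℝ) = x := by
    rw [← Real.rpow_add hx0]
    norm_num
  calc 4 * L * (((⌊(Real.exp B * (x : ℝ) ^ 3) ^ (1 / 4 : ℝ)⌋₊ + 1)
        * (⌊Real.log (Real.exp B * (x : ℝ) ^ 3) / Real.log 2⌋₊ + 1) * (2 * 3) : ℕ) : ℝ)
      = 4 * L * ((((⌊(Real.exp B * (x : ℝ) ^ 3) ^ (1 / 4 : ℝ)⌋₊ : ℕ) : ℝ) + 1)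
        * (((⌊Real.log (Real.exp B * (x : ℝ) ^ 3) / Real.log 2⌋₊ : ℕ) : ℝ) + 1) * 6) := by
        push_cast
        ring
    _ ≤ 4 * L * ((2 * (c₀ * (x : ℝ) ^ (3 / 4 : ℝ))) * (5 * L / Real.log 2) * 6) := by gcongr
    _ = 240 * c₀ / Real.log 2 * (x : ℝ) ^ (3 / 4 : ℝ) * L ^ 2 := by
        field_simp
        ring
    _ ≤ 240 * c₀ / Real.log 2 * (x : ℝ) ^ (3 / 4 : ℝ) * (η * (x : ℝ) ^ (1 / 4 : ℝ)) := by gcongr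
    _ = δ * ((x : ℝ) ^ (3 / 4 : ℝ) * (x : ℝ) ^ (1 / 4 : ℝ)) := by
        rw [hη]
        field_simp
    _ = δ * x := by rw [hx']

/-! ### `PP_g = o(x)` for cubic `g` -/

/-- **Proper prime powers among the values of a cubic Bateman–Horn polynomial are negligible:**
`∑_{1 ≤ n ≤ x, |g(n)| not prime} Λ(|g(n)|) = o(x)` — unconditionally, from Mathlib-level inputs only
(Dirichlet's theorem in Mertens form, quadratic reciprocity, Liouville spacing, the Selberg-type upper-bound
sieve of `Literature.NumberTheory.Sieve`). -/
theorem properPrimePow_sum_isLittleO_of_natDegree_three {g : ℤ[X]} (hg : IsBatemanHornSystem ![g])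
    (hdeg : g.natDegree = 3) :
    (fun x : ℕ => ∑ n ∈ (Icc 1 x).filter (fun n : ℕ => ¬Nat.Prime (g.eval (n : ℤ)).natAbs),
        Λ (g.eval (n : ℤ)).natAbs) =o[atTop] fun x : ℕ => (x : ℝ) := by
  have hirr : Irreducible g := by simpa using hg.irreducible 0
  have hdeg0 : 0 < g.natDegree := by omega
  have hlc : 0 < g.leadingCoeff := by simpa using hg.leadingCoeff_pos 0
  obtain ⟨n₀, hn₀⟩ := exists_eval_natCast_pos hdeg0 hlc
  obtain ⟨B, hB⟩ := exists_abs_log_natAbs_eval_sub_le hdeg0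
  have hB0 : 0 ≤ B := (abs_nonneg _).trans (hB 1 le_rfl)
  rw [isLittleO_iff]
  intro δ hδ
  have h1 := eventually_card_primeSq_mul_log_le hg (by omega) (show 0 < δ / 16 by positivity)
  have h2 := eventually_card_powValues_mul_log_le hirr (by omega) hlc (show 0 < δ / 16 by positivity)
  rw [hdeg] at h2
  have h3 := eventually_higherPow_count_mul_log_le_three hB0 (show 0 < δ / 4 by positivity)
  have h4 : ∀ᶠ x : ℕ in atTop, 4 * Real.log x * n₀ ≤ δ / 4 * x := by
    have hlo := (Real.isLittleO_log_id_atTop.comp_tendsto tendsto_natCast_atTop_atTop).def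
      (show 0 < δ / (16 * (n₀ + 1)) by positivity)
    filter_upwards [hlo, eventually_ge_atTop 1] with x hx hx1
    simp only [Function.comp_apply, id_eq, Real.norm_eq_abs] at hx
    rw [abs_of_nonneg (Real.log_nonneg (by exact_mod_cast hx1)), abs_of_nonneg (Nat.cast_nonneg x)] at hx
    have hn : (n₀ : ℝ) ≤ n₀ + 1 := by linarith
    calc 4 * Real.log x * n₀ ≤ 4 * (δ / (16 * (n₀ + 1)) * x) * (n₀ + 1) := by gcongr
      _ = δ / 4 * x := by
          field_simp
          ring
  have hlog : Tendsto (fun x : ℕ => Real.log x) atTop atTop :=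
    Real.tendsto_log_atTop.comp tendsto_natCast_atTop_atTop
  filter_upwards [h1, h2, h3, h4, hlog.eventually (eventually_ge_atTop B), eventually_ge_atTop 1]
    with x hx1 hx2 hx3 hx4 hBL hx
  have hL0 : 0 ≤ Real.log x := Real.log_nonneg (by exact_mod_cast hx)
  have hPP0 : 0 ≤ ∑ n ∈ (Icc 1 x).filter (fun n : ℕ => ¬Nat.Prime (g.eval (n : ℤ)).natAbs),
      Λ (g.eval (n : ℤ)).natAbs := sum_nonneg fun n _ => vonMangoldt_nonneg
  rw [Real.norm_eq_abs, Real.norm_eq_abs, abs_of_nonneg hPP0, abs_of_nonneg (Nat.cast_nonneg x)]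
  have hmain := properPrimePow_polyVal_sum_le_three g hdeg hn₀ hB hx
  have hhi := card_biUnion_natAbs_eval_eq_pow_le g hdeg0 (Icc 1 x)
    ⌊(Real.exp B * (x : ℝ) ^ 3) ^ (1 / 4 : ℝ)⌋₊ ⌊Real.log (Real.exp B * (x : ℝ) ^ 3) / Real.log 2⌋₊
  rw [hdeg] at hhi
  have hhi' : (#((range (⌊(Real.exp B * (x : ℝ) ^ 3) ^ (1 / 4 : ℝ)⌋₊ + 1)).biUnion fun m : ℕ =>
      (range (⌊Real.log (Real.exp B * (x : ℝ) ^ 3) / Real.log 2⌋₊ + 1)).biUnion fun k : ℕ =>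
        (Icc 1 x).filter fun n : ℕ => (g.eval (n : ℤ)).natAbs = m ^ k) : ℝ)
      ≤ (((⌊(Real.exp B * (x : ℝ) ^ 3) ^ (1 / 4 : ℝ)⌋₊ + 1)
        * (⌊Real.log (Real.exp B * (x : ℝ) ^ 3) / Real.log 2⌋₊ + 1) * (2 * 3) : ℕ) : ℝ) := by
    exact_mod_cast hhi
  have h3L : 3 * Real.log x + B ≤ 4 * Real.log x := by linarith
  calc ∑ n ∈ (Icc 1 x).filter (fun n : ℕ => ¬Nat.Prime (g.eval (n : ℤ)).natAbs), Λ (g.eval (n : ℤ)).natAbs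
      ≤ (4 * Real.log x) * (n₀
          + #((Icc 1 x).filter fun n : ℕ => ∃ p : ℕ, p.Prime ∧ g.eval (n : ℤ) = (p : ℤ) ^ 2)
          + #((Icc 1 x).filter fun n : ℕ => ∃ m : ℕ, (g.eval (n : ℤ)).natAbs = m ^ 3)
          + (((⌊(Real.exp B * (x : ℝ) ^ 3) ^ (1 / 4 : ℝ)⌋₊ + 1)
            * (⌊Real.log (Real.exp B * (x : ℝ) ^ 3) / Real.log 2⌋₊ + 1) * (2 * 3) : ℕ) : ℝ)) := by
        refine hmain.trans ?_
        have h4L : 0 ≤ 4 * Real.log x := by positivity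
        gcongr
    _ = 4 * Real.log x * n₀
          + 4 * (#((Icc 1 x).filter fun n : ℕ => ∃ p : ℕ, p.Prime ∧ g.eval (n : ℤ) = (p : ℤ) ^ 2)
              * Real.log x)
          + 4 * (#((Icc 1 x).filter fun n : ℕ => ∃ m : ℕ, (g.eval (n : ℤ)).natAbs = m ^ 3)
              * Real.log x)
          + 4 * Real.log x * (((⌊(Real.exp B * (x : ℝ) ^ 3) ^ (1 / 4 : ℝ)⌋₊ + 1)
            * (⌊Real.log (Real.exp B * (x : ℝ) ^ 3) / Real.log 2⌋₊ + 1) * (2 * 3) : ℕ) : ℝ) := by ring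
    _ ≤ δ / 4 * x + 4 * (δ / 16 * x) + 4 * (δ / 16 * x) + δ / 4 * x := by gcongr
    _ = δ * x := by ring

/-! ### The localisation for cubic polynomials -/

/-- **`BatemanHornAsymptotic ![g] ⟺ ∑_{n ≤ x} Λ(|g(n)|) ~ C(g) x`** for every cubic Bateman–Horn polynomial. -/
theorem batemanHornAsymptotic_iff_isEquivalent_psi_of_natDegree_three {g : ℤ[X]}
    (hg : IsBatemanHornSystem ![g]) (hdeg : g.natDegree = 3) :
    BatemanHornAsymptotic ![g] ↔
      ((fun x : ℕ => ∑ n ∈ Icc 1 x, Λ (g.eval (n : ℤ)).natAbs) ~[atTop]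
        fun x : ℕ => batemanHornConst ![g] * (x : ℝ)) :=
  batemanHornAsymptotic_iff_isEquivalent_psi_of_properPrimePow hg
    (properPrimePow_sum_isLittleO_of_natDegree_three hg hdeg)

/-- **`BatemanHornAsymptotic ![g] ⟺ T_g(x; y) = o(x)`** for every cubic Bateman–Horn polynomial and every
admissible cut `y → ∞`, `y log y = o(x)`. -/
theorem batemanHornAsymptotic_iff_largeDivisorSum_isLittleO_of_natDegree_three {g : ℤ[X]}
    (hg : IsBatemanHornSystem ![g]) (hdeg : g.natDegree = 3)
    {y : ℕ → ℕ} (hy : Tendsto y atTop atTop)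
    (hy' : (fun x : ℕ => Real.log (y x) * (y x : ℝ)) =o[atTop] fun x : ℕ => (x : ℝ)) :
    BatemanHornAsymptotic ![g] ↔
      (fun x : ℕ => ∑ n ∈ Icc 1 x,
          ∑ e ∈ ((g.eval (n : ℤ)).natAbs).divisors with y x < (g.eval (n : ℤ)).natAbs / e,
            (μ ((g.eval (n : ℤ)).natAbs / e) : ℝ) * Real.log ((((g.eval (n : ℤ)).natAbs / e : ℕ)) : ℝ))
        =o[atTop] fun x : ℕ => (x : ℝ) :=
  batemanHornAsymptotic_iff_largeDivisorSum_isLittleO_of_properPrimePow hg (by omega)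
    (properPrimePow_sum_isLittleO_of_natDegree_three hg hdeg) hy hy'

/-- **`BatemanHornAsymptotic ![g] ⟺ T_g(x; x^{1-ε}) = o(x)`** (`0 < ε < 1`) for every cubic Bateman–Horn
polynomial `g`: the conjunct's instance for `g` is exactly the cancellation of `μ · log` over the divisors
`d > x^{1-ε}` of the values `|g(n)| ≍ x³`. -/
theorem batemanHornAsymptotic_iff_largeDivisorSum_isLittleO_rpowCut_of_natDegree_three {g : ℤ[X]}
    (hg : IsBatemanHornSystem ![g]) (hdeg : g.natDegree = 3) {ε : ℝ} (hε : 0 < ε) (hε1 : ε < 1) :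
    BatemanHornAsymptotic ![g] ↔
      (fun x : ℕ => ∑ n ∈ Icc 1 x,
          ∑ e ∈ ((g.eval (n : ℤ)).natAbs).divisors with
              ⌊(x : ℝ) ^ (1 - ε)⌋₊ < (g.eval (n : ℤ)).natAbs / e,
            (μ ((g.eval (n : ℤ)).natAbs / e) : ℝ) * Real.log ((((g.eval (n : ℤ)).natAbs / e : ℕ)) : ℝ))
        =o[atTop] fun x : ℕ => (x : ℝ) :=
  batemanHornAsymptotic_iff_largeDivisorSum_isLittleO_rpowCut_of_properPrimePow hg (by omega)
    (properPrimePow_sum_isLittleO_of_natDegree_three hg hdeg) hε hε1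

end Summit.Parity.BatemanHorn.Theorems
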